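import Literature.Analysis.Fourier.ParsevalCompactQuotient
import Literature.NumberTheory.Automorphic.AdelicPoissonSummation
import HarnessLib

/-!
# Parseval's identity on `𝔸_K ⧸ K` and on `𝔸_K^ι ⧸ K^ι`
(Tate, *Fourier analysis in number fields and Hecke's zeta-functions*, Ch. XV of Cassels–Fröhlich
(1967), Thm. 4.1.4 (`K^⊥ = K`) and Lemma 4.2.1; Deitmar–Echterhoff (2014), Cor. 3.4.9)

Topic `NumberTheory/Automorphic`; namespace `Literature.NumberTheory.Automorphic`. Sequel to
`AdeleQuotientFourier` (the characters `ψ_ξ(u) = ψ_K(ξ u)`, `ξ ∈ K`, of the compact group `𝔸_K ⧸ K`,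
its Haar probability measure `adeleQuotHaar K`, **Bessel's inequality**
`tsum_norm_sq_integral_conj_adeleQuotChar_mul_le` and completeness) and `AdelicPoissonSummation`
(the lattice `K^ι ⊂ 𝔸_K^ι`, the product fundamental domain `D^ι = piFundamentalDomain K ι`, the
characters `ψ_ξ(v) = ψ_K(∑ ξ_i v_i)`, `ξ ∈ K^ι`, injective and separating the points of `𝔸_K^ι ⧸ K^ι`).
Specialising the abstract Parseval identity of `Literature.Analysis.Fourier.ParsevalCompactQuotient`
we PROVE the **equality** in Bessel's inequality:

* `hasSum_norm_sq_integral_conj_adeleQuotChar_mul` (+ `tsum_…`) — for `f ∈ L²(𝔸_K ⧸ K)`,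
  `∑_{ξ ∈ K} |∫ conj ψ(ξ u) f(u) du|² = ∫ |f|²`;
* `AdeleRing.hasSum_norm_sq_setIntegral_adeleFundamentalDomain` — for `F : 𝔸_K → ℂ` continuous and
  `K`-periodic and any additive Haar measure `μ` on `𝔸_K`,
  `∑_{ξ ∈ K} |∫_D conj ψ(ξ x) F(x) dμ|² = μ(D) ∫_D |F|² dμ` on Tate's fundamental domain `D`;
* `AdeleRing.hasSum_norm_sq_setIntegral_piFundamentalDomain` (+ the normalised form
  `AdeleRing.hasSum_norm_sq_inv_smul_setIntegral_piFundamentalDomain`, the `tsum` form and the finite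
  Bessel form `AdeleRing.sum_norm_sq_setIntegral_piFundamentalDomain_le`) — for `ι` finite,
  `F : 𝔸_K^ι → ℂ` continuous and `K^ι`-periodic and any additive Haar measure `ν` on `𝔸_K^ι`,
  `∑_{ξ ∈ K^ι} |∫_{D^ι} conj ψ(∑ ξ_i v_i) F(v) dν|² = ν(D^ι) ∫_{D^ι} |F|² dν`.

The last statement is the **mean-square identity along an abelian unipotent quotient**
`U(K) \ U(𝔸_K) ≅ K^m \ 𝔸_K^m` consumed by the `L²` (real-point Rankin–Selberg) treatment of the
Fourier–Whittaker coefficients of cusp forms on `GL_n` (Jacquet–Shalika (1981), §4; Cogdell (2004),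
§1.1, §2.3), in which `∫_{U(K)\U(𝔸)} |φ(u g)|² du` is unfolded as the sum of the squared moduli of
the Fourier coefficients of `u ↦ φ(u g)`: that application is not made here.

## References

* J. Tate, in J. W. S. Cassels, A. Fröhlich (eds.), *Algebraic Number Theory* (1967), Ch. XV,
  Thm. 4.1.4 and Lemma 4.2.1 (PDF pp. 357–360 of the held copy) [CasselsFrohlichANT1967].
* A. Deitmar, S. Echterhoff, *Principles of Harmonic Analysis*, Universitext (2014), Cor. 3.4.9
  (PDF p. 116 of the held copy) [DeitmarEchterhoff2014].
-/

noncomputable section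

open scoped ComplexConjugate ENNReal
open NumberField IsDedekindDomain MeasureTheory Function

namespace Literature.NumberTheory.Automorphic

/-! ### Parseval on `𝔸_K ⧸ K` -/

section One

variable (K : Type) [Field K] [NumberField K]

/-- **Parseval's identity on `𝔸_K ⧸ K`**: for `f ∈ L²` of the Haar probability measure,
`∑_{ξ ∈ K} |∫ conj ψ(ξ u) f(u) du|² = ∫ |f(u)|² du` — equality in Bessel's inequality
`tsum_norm_sq_integral_conj_adeleQuotChar_mul_le` (the characters `ψ_ξ` form a Hilbert basis of
`L²(𝔸_K ⧸ K)`: orthonormal, and complete because they separate points, `K^⊥ = K`, Tate Thm. 4.1.4).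
[cite: DeitmarEchterhoff2014, Cor. 3.4.9] -/
theorem hasSum_norm_sq_integral_conj_adeleQuotChar_mul
    [MeasurableSpace (adeleQuotient K)] [BorelSpace (adeleQuotient K)]
    {f : adeleQuotient K → ℂ} (hf : MemLp f 2 (adeleQuotHaar K)) :
    HasSum (fun ξ : K => ‖∫ u, conj (adeleQuotChar K ξ u : ℂ) * f u ∂(adeleQuotHaar K)‖ ^ 2)
      (∫ u, ‖f u‖ ^ 2 ∂(adeleQuotHaar K)) :=
  Literature.Analysis.Fourier.hasSum_norm_sq_integral_conj_addChar_mul (adeleQuotHaar K)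
    (adeleQuotCharHom K) (adeleQuotChar_injective K) (continuous_adeleQuotChar K)
    (fun _ hu => exists_adeleQuotChar_ne_one K hu) hf

/-- `tsum` form of Parseval's identity on `𝔸_K ⧸ K`. [cite: DeitmarEchterhoff2014, Cor. 3.4.9] -/
theorem tsum_norm_sq_integral_conj_adeleQuotChar_mul
    [MeasurableSpace (adeleQuotient K)] [BorelSpace (adeleQuotient K)]
    {f : adeleQuotient K → ℂ} (hf : MemLp f 2 (adeleQuotHaar K)) :
    ∑' ξ : K, ‖∫ u, conj (adeleQuotChar K ξ u : ℂ) * f u ∂(adeleQuotHaar K)‖ ^ 2 =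
      ∫ u, ‖f u‖ ^ 2 ∂(adeleQuotHaar K) :=
  (hasSum_norm_sq_integral_conj_adeleQuotChar_mul K hf).tsum_eq

/-- Parseval's identity on `𝔸_K ⧸ K` for a continuous function. [cite: DeitmarEchterhoff2014, Cor. 3.4.9] -/
theorem hasSum_norm_sq_integral_conj_adeleQuotChar_mul_of_continuous
    [MeasurableSpace (adeleQuotient K)] [BorelSpace (adeleQuotient K)]
    {f : adeleQuotient K → ℂ} (hf : Continuous f) :
    HasSum (fun ξ : K => ‖∫ u, conj (adeleQuotChar K ξ u : ℂ) * f u ∂(adeleQuotHaar K)‖ ^ 2)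
      (∫ u, ‖f u‖ ^ 2 ∂(adeleQuotHaar K)) :=
  hasSum_norm_sq_integral_conj_adeleQuotChar_mul K (memLp_of_continuous K hf)

/-- **Parseval on Tate's fundamental domain.** For any additive Haar measure `μ` on `𝔸_K` and
`F : 𝔸_K → ℂ` continuous and `K`-periodic,
`∑_{ξ ∈ K} |∫_D conj ψ(ξ x) F(x) dμ(x)|² = μ(D) · ∫_D |F(x)|² dμ(x)`, `D = adeleFundamentalDomain K`
(Parseval on `𝔸_K ⧸ K` and Tate's Lemma 4.2.1, `∫_D G(x + K) dμ = μ(D) ∫_{𝔸_K ⧸ K} G`).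
[cite: CasselsFrohlichANT1967, Ch. XV Lemma 4.2.1] -/
theorem AdeleRing.hasSum_norm_sq_setIntegral_adeleFundamentalDomain
    [MeasurableSpace (AdeleRing (𝓞 K) K)] [BorelSpace (AdeleRing (𝓞 K) K)]
    (μ : Measure (AdeleRing (𝓞 K) K)) [μ.IsAddHaarMeasure]
    {F : AdeleRing (𝓞 K) K → ℂ} (hFc : Continuous F)
    (hF : ∀ (x : AdeleRing (𝓞 K) K) (ξ : K), F (x + algebraMap K (AdeleRing (𝓞 K) K) ξ) = F x) :
    HasSum (fun ξ : K => ‖∫ x in adeleFundamentalDomain K,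
        conj (adeleAddChar K (algebraMap K (AdeleRing (𝓞 K) K) ξ * x) : ℂ) * F x ∂μ‖ ^ 2)
      ((μ (adeleFundamentalDomain K)).toReal * ∫ x in adeleFundamentalDomain K, ‖F x‖ ^ 2 ∂μ) := by
  haveI := locallyCompactSpace_adeleRing' K
  haveI := secondCountableTopology_adeleRing K
  haveI : Countable K := NumberField.countable' (K := K)
  letI : MeasurableSpace (adeleQuotient K) := borel _
  haveI : BorelSpace (adeleQuotient K) := ⟨rfl⟩
  have hF' : ∀ (x : AdeleRing (𝓞 K) K) (γ : AdeleRing.principalSubgroup (𝓞 K) K),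
      F (x + γ) = F x := by
    rintro x ⟨_, ξ, rfl⟩
    exact hF x ξ
  have h := Literature.Analysis.Fourier.hasSum_norm_sq_setIntegral_of_periodic μ (adeleQuotCharHom K)
    (isClosed_principalSubgroup K) (isAddFundamentalDomain_op_adeleFundamentalDomain K μ)
    (measure_adeleFundamentalDomain_lt_top K μ).ne (adeleQuotChar_injective K)
    (continuous_adeleQuotChar K) (fun _ hu => exists_adeleQuotChar_ne_one K hu) hFc hF'
  simpa only [adeleQuotCharHom_apply, adeleQuotChar_mk] using h

end One

/-! ### Parseval on `𝔸_K^ι ⧸ K^ι` -/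

section Pi

variable (K : Type) [Field K] [NumberField K] (ι : Type) [Fintype ι]

/-- **Parseval on `𝔸_K^ι ⧸ K^ι` through the product fundamental domain.** For `ι` finite, any
additive Haar measure `ν` on `𝔸_K^ι` and `F : 𝔸_K^ι → ℂ` continuous and `K^ι`-periodic,
`∑_{ξ ∈ K^ι} |∫_{D^ι} conj ψ(∑_i ξ_i v_i) F(v) dν(v)|² = ν(D^ι) · ∫_{D^ι} |F(v)|² dν(v)`
(the characters `ψ_ξ`, `ξ ∈ K^ι`, form a Hilbert basis of `L²(𝔸_K^ι ⧸ K^ι)`: injective,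
`piQuotCharHom_injective`, and separating, `exists_piQuotChar_ne_one`; Tate's Lemma 4.2.1 for the
passage to `D^ι`). This is the mean-square identity along `U(K) \ U(𝔸_K) ≅ K^m \ 𝔸_K^m` for an
abelian unipotent `U ≅ 𝔾_a^m`. [cite: DeitmarEchterhoff2014, Cor. 3.4.9] -/
theorem AdeleRing.hasSum_norm_sq_setIntegral_piFundamentalDomain
    [MeasurableSpace (AdeleRing (𝓞 K) K)] [BorelSpace (AdeleRing (𝓞 K) K)]
    (ν : Measure (ι → AdeleRing (𝓞 K) K)) [ν.IsAddHaarMeasure]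
    {F : (ι → AdeleRing (𝓞 K) K) → ℂ} (hFc : Continuous F)
    (hF : ∀ (v : ι → AdeleRing (𝓞 K) K) (ξ : ι → K),
      F (v + fun i => algebraMap K (AdeleRing (𝓞 K) K) (ξ i)) = F v) :
    HasSum (fun ξ : ι → K => ‖∫ v in piFundamentalDomain K ι,
        conj (adeleAddChar K (∑ i, algebraMap K (AdeleRing (𝓞 K) K) (ξ i) * v i) : ℂ) * F v ∂ν‖ ^ 2)
      ((ν (piFundamentalDomain K ι)).toReal * ∫ v in piFundamentalDomain K ι, ‖F v‖ ^ 2 ∂ν) := by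
  haveI := locallyCompactSpace_adeleRing' K
  haveI := secondCountableTopology_adeleRing K
  haveI := t2Space_adeleRing K
  haveI : Countable K := NumberField.countable' (K := K)
  haveI : BorelSpace (ι → AdeleRing (𝓞 K) K) := Pi.borelSpace
  letI : MeasurableSpace ((ι → AdeleRing (𝓞 K) K) ⧸ piPrincipalSubgroup K ι) := borel _
  haveI : BorelSpace ((ι → AdeleRing (𝓞 K) K) ⧸ piPrincipalSubgroup K ι) := ⟨rfl⟩
  have hfin : ν (piFundamentalDomain K ι) ≠ ⊤ :=
    ((measure_mono subset_closure).trans_lt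
      (isCompact_closure_piFundamentalDomain K ι).measure_lt_top).ne
  have hF' : ∀ (v : ι → AdeleRing (𝓞 K) K) (γ : piPrincipalSubgroup K ι), F (v + γ) = F v := by
    intro v γ
    obtain ⟨ξ, hξ⟩ := (piPrincipalSubgroupEquiv K ι).surjective γ
    have : (γ : ι → AdeleRing (𝓞 K) K) = fun i => algebraMap K (AdeleRing (𝓞 K) K) (ξ i) := by
      rw [← hξ, coe_piPrincipalSubgroupEquiv]
    rw [this]
    exact hF v ξ
  have h := Literature.Analysis.Fourier.hasSum_norm_sq_setIntegral_of_periodic ν (piQuotCharHom K ι)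
    (isClosed_piPrincipalSubgroup K ι) (isAddFundamentalDomain_op_piFundamentalDomain K ι ν) hfin
    (piQuotCharHom_injective K ι) (continuous_piQuotChar K)
    (fun _ hu => exists_piQuotChar_ne_one K ι hu) hFc hF'
  simpa only [piQuotCharHom_apply, piQuotChar_mk, piPairing_apply] using h

/-- `tsum` form of Parseval on `𝔸_K^ι ⧸ K^ι`. [cite: DeitmarEchterhoff2014, Cor. 3.4.9] -/
theorem AdeleRing.tsum_norm_sq_setIntegral_piFundamentalDomain
    [MeasurableSpace (AdeleRing (𝓞 K) K)] [BorelSpace (AdeleRing (𝓞 K) K)]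
    (ν : Measure (ι → AdeleRing (𝓞 K) K)) [ν.IsAddHaarMeasure]
    {F : (ι → AdeleRing (𝓞 K) K) → ℂ} (hFc : Continuous F)
    (hF : ∀ (v : ι → AdeleRing (𝓞 K) K) (ξ : ι → K),
      F (v + fun i => algebraMap K (AdeleRing (𝓞 K) K) (ξ i)) = F v) :
    ∑' ξ : ι → K, ‖∫ v in piFundamentalDomain K ι,
        conj (adeleAddChar K (∑ i, algebraMap K (AdeleRing (𝓞 K) K) (ξ i) * v i) : ℂ) * F v ∂ν‖ ^ 2 =
      (ν (piFundamentalDomain K ι)).toReal * ∫ v in piFundamentalDomain K ι, ‖F v‖ ^ 2 ∂ν :=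
  (AdeleRing.hasSum_norm_sq_setIntegral_piFundamentalDomain K ι ν hFc hF).tsum_eq

/-- **Bessel on `D^ι`, finite form**: every finite partial sum of the squared Fourier coefficients
over `D^ι` is at most `ν(D^ι) ∫_{D^ι} |F|²`. [folklore] -/
theorem AdeleRing.sum_norm_sq_setIntegral_piFundamentalDomain_le
    [MeasurableSpace (AdeleRing (𝓞 K) K)] [BorelSpace (AdeleRing (𝓞 K) K)]
    (ν : Measure (ι → AdeleRing (𝓞 K) K)) [ν.IsAddHaarMeasure]
    {F : (ι → AdeleRing (𝓞 K) K) → ℂ} (hFc : Continuous F)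
    (hF : ∀ (v : ι → AdeleRing (𝓞 K) K) (ξ : ι → K),
      F (v + fun i => algebraMap K (AdeleRing (𝓞 K) K) (ξ i)) = F v) (s : Finset (ι → K)) :
    ∑ ξ ∈ s, ‖∫ v in piFundamentalDomain K ι,
        conj (adeleAddChar K (∑ i, algebraMap K (AdeleRing (𝓞 K) K) (ξ i) * v i) : ℂ) * F v ∂ν‖ ^ 2 ≤
      (ν (piFundamentalDomain K ι)).toReal * ∫ v in piFundamentalDomain K ι, ‖F v‖ ^ 2 ∂ν :=
  sum_le_hasSum s (fun ξ _ => by positivity)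
    (AdeleRing.hasSum_norm_sq_setIntegral_piFundamentalDomain K ι ν hFc hF)

/-- **Normalised form** (`ν(D^ι)⁻¹ • ∫_{D^ι}`, the probability normalisation of the constant terms
and Whittaker coefficients of the `GL_n` files): for `F` continuous and `K^ι`-periodic,
`∑_{ξ ∈ K^ι} |ν(D^ι)⁻¹ ∫_{D^ι} conj ψ(∑ ξ_i v_i) F(v) dν|² = ν(D^ι)⁻¹ ∫_{D^ι} |F|² dν`, i.e. the
`L²`-norm of `F` on `K^ι \ 𝔸_K^ι` for the probability Haar measure is the `ℓ²`-norm of its Fourier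
coefficients. [cite: DeitmarEchterhoff2014, Cor. 3.4.9] -/
theorem AdeleRing.hasSum_norm_sq_inv_smul_setIntegral_piFundamentalDomain
    [MeasurableSpace (AdeleRing (𝓞 K) K)] [BorelSpace (AdeleRing (𝓞 K) K)]
    (ν : Measure (ι → AdeleRing (𝓞 K) K)) [ν.IsAddHaarMeasure]
    {F : (ι → AdeleRing (𝓞 K) K) → ℂ} (hFc : Continuous F)
    (hF : ∀ (v : ι → AdeleRing (𝓞 K) K) (ξ : ι → K),
      F (v + fun i => algebraMap K (AdeleRing (𝓞 K) K) (ξ i)) = F v) :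
    HasSum (fun ξ : ι → K => ‖((ν (piFundamentalDomain K ι)).toReal⁻¹ : ℝ) •
        ∫ v in piFundamentalDomain K ι,
          conj (adeleAddChar K (∑ i, algebraMap K (AdeleRing (𝓞 K) K) (ξ i) * v i) : ℂ) * F v ∂ν‖ ^ 2)
      ((ν (piFundamentalDomain K ι)).toReal⁻¹ * ∫ v in piFundamentalDomain K ι, ‖F v‖ ^ 2 ∂ν) := by
  haveI := locallyCompactSpace_adeleRing' K
  haveI := secondCountableTopology_adeleRing K
  haveI := t2Space_adeleRing K
  haveI : Countable K := NumberField.countable' (K := K)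
  haveI : BorelSpace (ι → AdeleRing (𝓞 K) K) := Pi.borelSpace
  letI : MeasurableSpace ((ι → AdeleRing (𝓞 K) K) ⧸ piPrincipalSubgroup K ι) := borel _
  haveI : BorelSpace ((ι → AdeleRing (𝓞 K) K) ⧸ piPrincipalSubgroup K ι) := ⟨rfl⟩
  have hfin : ν (piFundamentalDomain K ι) ≠ ⊤ :=
    ((measure_mono subset_closure).trans_lt
      (isCompact_closure_piFundamentalDomain K ι).measure_lt_top).ne
  have hF' : ∀ (v : ι → AdeleRing (𝓞 K) K) (γ : piPrincipalSubgroup K ι), F (v + γ) = F v := by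
    intro v γ
    obtain ⟨ξ, hξ⟩ := (piPrincipalSubgroupEquiv K ι).surjective γ
    have : (γ : ι → AdeleRing (𝓞 K) K) = fun i => algebraMap K (AdeleRing (𝓞 K) K) (ξ i) := by
      rw [← hξ, coe_piPrincipalSubgroupEquiv]
    rw [this]
    exact hF v ξ
  have h := Literature.Analysis.Fourier.hasSum_norm_sq_inv_smul_setIntegral_of_periodic ν
    (piQuotCharHom K ι) (isClosed_piPrincipalSubgroup K ι)
    (isAddFundamentalDomain_op_piFundamentalDomain K ι ν) hfin (piQuotCharHom_injective K ι)
    (continuous_piQuotChar K) (fun _ hu => exists_piQuotChar_ne_one K ι hu) hFc hF'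
  simpa only [piQuotCharHom_apply, piQuotChar_mk, piPairing_apply] using h

end Pi

end Literature.NumberTheory.Automorphic
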